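import Literature.NumberTheory.GaloisRepresentations.RelativeCorestrictionTransitive
import Literature.NumberTheory.ComplexMultiplication.EllipticUnits.ImaginaryQuadraticMainConjectureCarriersOCores
import HarnessLib

/-!
# The corestrictions `cor_{F'/F}` of the `𝒪`-coefficient level groups `H^i(G_S(F), 𝒪 ⊗ μ_{p^k} ⊗ θ)` are TRANSITIVE in every degree

INPUTS hand `bsd-inputs-honda-p1` g27; sequel of g22's `…CarriersOCores.lean` (which has the degree-`1` case `relCoresO_relCoresO_one` through the
transfer model `coresLe`). THEOREMS ONLY (no definition, no named fact, no instance, no `sorry`). With the all-degree transitivity of the relative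
corestriction (`relCor_relCor`, `GaloisRepresentations/RelativeCorestrictionTransitive.lean`: `cor_cor_subgroupOf` + transport along the tautological
isomorphism of pairs) and the identification `relCoresO = relCor` (`relCoresO_eq_relCor`, definitional), **`relCoresO_relCoresO`**:
`cor_{F'/F} (cor_{F''/F'} c) = cor_{F''/F} c` on `H^i(G_S(F''), 𝒪 ⊗ μ_{p^k} ⊗ θ)` for open `U'' ≤ U' ≤ U`, every `i` — the compatibility the degree-`2`
specialisation `sp²` of the junction of crux `SmallImageLowerHalfBothSigns` (stmt-BirchSwinnertonDyer-23599, line `rtt_w3`, row S3α brick α1) needs for its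
corestricted families (`Theorems/…RttJunctionShaSp2Map.lean`). Nothing about BSD or Cor. 5.3 is proved.

References: [NeukirchSchmidtWingberg2008] I §5 Prop. 1.5.3 (iii); [SerreGaloisCohomology1997] I §2.5; [JohnsonLeungKings2011] Def. 4.2 (94) (arXiv p0012:L94).
-/

noncomputable section

/-!
### Transitivity of `relCoresO` in all degrees
-/

namespace Literature.NumberTheory.ComplexMultiplication.EllipticUnits.JohnsonLeungKings2011

open scoped NumberField
open Literature.NumberTheory.GaloisRepresentations Literature.NumberTheory.EllipticCurves CategoryTheory Field IsDedekindDomain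

variable {K : Type} [Field K] [NumberField K] {p : ℕ} [Fact p.Prime] (S : Set (PadicAlgCl p))
  (P : Set (HeightOneSpectrum (𝓞 K))) (θ : absoluteGaloisGroup K →ₜ* (padicCoeffIntegers S)ˣ)

/-- **`relCoresO` IS `relCor`** (with the `Fintype.ofFinite` instance on the coset space), every degree. [cite: SerreGaloisCohomology1997, I §2.5] -/
theorem relCoresO_eq_relCor {U U' : Subgroup (absoluteGaloisGroup K)} (h : U' ≤ U) (hU : IsOpen (U : Set (absoluteGaloisGroup K)))
    (hU' : IsOpen (U' : Set (absoluteGaloisGroup K))) (k i : ℕ) (c : levelCohO S P θ U' k i) :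
    haveI : TotallyDisconnectedSpace (GaloisGroupUnramifiedOutside K P) :=
      Literature.GroupTheory.ProfiniteSubquotients.totallyDisconnectedSpace_quotient (ramificationSubgroup K P) (ramificationSubgroup_isClosed K P)
    haveI : IsClosed ((imGS P U : Subgroup (GaloisGroupUnramifiedOutside K P)) : Set (GaloisGroupUnramifiedOutside K P)) := isClosed_imGS' P hU
    haveI : IsClosed ((imGS P U' : Subgroup (GaloisGroupUnramifiedOutside K P)) : Set (GaloisGroupUnramifiedOutside K P)) := isClosed_imGS' P hU'
    haveI : ((imGS P U').subgroupOf (imGS P U)).FiniteIndex := by haveI := finiteIndex_imGS' P hU'; infer_instance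
    letI : Fintype (↥(imGS P U) ⧸ (imGS P U').subgroupOf (imGS P U)) := Fintype.ofFinite _
    relCoresO S P θ h hU hU' k i c = (relCor (imGS P U) (imGS P U') (coeffGSO S P θ k) (imGS_le_of_le P h) i).hom c := by
  rfl

/-- ★ **TRANSITIVITY OF THE CORESTRICTIONS `cor_{F'/F}` OF THE `𝒪`-COEFFICIENT LEVEL GROUPS IN EVERY DEGREE**:
`cor_{F'/F} (cor_{F''/F'} c) = cor_{F''/F} c` on `H^i(G_S(F''), 𝒪 ⊗ μ_{p^k} ⊗ θ)` for open `U'' ≤ U' ≤ U` (the degree-`1` case is `relCoresO_relCoresO_one`;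
all degrees via `relCor_relCor`, Serre I §2.5 / NSW I (1.5.3) (iii)) — the compatibility that the degree-`2` specialisation of the junction (crux
`SmallImageLowerHalfBothSigns`, row S3α brick α1) needs for its corestricted families. [cite: NeukirchSchmidtWingberg2008, I §5 Prop. 1.5.3 (iii)] [cite: JohnsonLeungKings2011, Def. 4.2 (94) (arXiv p0012:L94)] -/
theorem relCoresO_relCoresO {U U' U'' : Subgroup (absoluteGaloisGroup K)} (h' : U'' ≤ U') (h : U' ≤ U)
    (hU : IsOpen (U : Set (absoluteGaloisGroup K))) (hU' : IsOpen (U' : Set (absoluteGaloisGroup K))) (hU'' : IsOpen (U'' : Set (absoluteGaloisGroup K)))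
    (k i : ℕ) (c : levelCohO S P θ U'' k i) :
    relCoresO S P θ h hU hU' k i (relCoresO S P θ h' hU' hU'' k i c) = relCoresO S P θ (h'.trans h) hU hU'' k i c := by
  haveI : TotallyDisconnectedSpace (GaloisGroupUnramifiedOutside K P) :=
    Literature.GroupTheory.ProfiniteSubquotients.totallyDisconnectedSpace_quotient (ramificationSubgroup K P) (ramificationSubgroup_isClosed K P)
  haveI hV : IsClosed ((imGS P U : Subgroup (GaloisGroupUnramifiedOutside K P)) : Set (GaloisGroupUnramifiedOutside K P)) := isClosed_imGS' P hU
  haveI hV' : IsClosed ((imGS P U' : Subgroup (GaloisGroupUnramifiedOutside K P)) : Set (GaloisGroupUnramifiedOutside K P)) := isClosed_imGS' P hU'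
  haveI hV'' : IsClosed ((imGS P U'' : Subgroup (GaloisGroupUnramifiedOutside K P)) : Set (GaloisGroupUnramifiedOutside K P)) := isClosed_imGS' P hU''
  haveI : ((imGS P U').subgroupOf (imGS P U)).FiniteIndex := by haveI := finiteIndex_imGS' P hU'; infer_instance
  haveI : ((imGS P U'').subgroupOf (imGS P U')).FiniteIndex := by haveI := finiteIndex_imGS' P hU''; infer_instance
  haveI : ((imGS P U'').subgroupOf (imGS P U)).FiniteIndex := by haveI := finiteIndex_imGS' P hU''; infer_instance
  haveI : (subThree (imGS P U) (imGS P U') (imGS P U'')).FiniteIndex := by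
    haveI := finiteIndex_imGS' P hU''
    change (((imGS P U'').subgroupOf (imGS P U)).subgroupOf ((imGS P U').subgroupOf (imGS P U))).FiniteIndex
    infer_instance
  letI : Fintype (↥(imGS P U) ⧸ (imGS P U').subgroupOf (imGS P U)) := Fintype.ofFinite _
  letI : Fintype (↥(imGS P U') ⧸ (imGS P U'').subgroupOf (imGS P U')) := Fintype.ofFinite _
  letI : Fintype (↥(imGS P U) ⧸ (imGS P U'').subgroupOf (imGS P U)) := Fintype.ofFinite _
  letI : Fintype (↥((imGS P U').subgroupOf (imGS P U)) ⧸ subThree (imGS P U) (imGS P U') (imGS P U'')) := Fintype.ofFinite _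
  rw [relCoresO_eq_relCor, relCoresO_eq_relCor, relCoresO_eq_relCor]
  exact relCor_relCor (imGS P U) (imGS P U') (imGS P U'') (coeffGSO S P θ k) (imGS_le_of_le P h) (imGS_le_of_le P h') i c

end Literature.NumberTheory.ComplexMultiplication.EllipticUnits.JohnsonLeungKings2011

end
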